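import Summits.ValiantsHypothesis.ValiantsHypothesis.Theorems.RefutationDegreeMrCalibrationMinors

/-!
# Route `RefutationDegree`, item `MrCalibration` (stmt-ValiantsHypothesis-5647) — degree-bounded
# ideal membership ("Nullstellensatz combinations")

Helper file (no definitions). For a polynomial `P ∈ R[x]`, `R = K[a]` a polynomial ring, the item
`MrCalibration` asks for a certificate `Σ_{μ ∈ supp P} h_μ · coeff_μ P = 1` with a bound on the
total degrees (in `a`) of the products `h_μ · coeff_μ P`. This file provides the bookkeeping for
the property "`f = Σ_{μ ∈ supp P} h_μ · coeff_μ P` with `deg h_μ ≤ d` for all `μ`", written inline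
(local notation `LC[P, d, f]`): it holds for explicit combinations of the coefficients
(`lc_of_coeffs`), is stable under `0`, `+`, `-`, finite sums, and multiplication by a polynomial of
degree `≤ e` at the cost `d ↦ e + d` (`lc_mul`), and — the one non-trivial instance — it passes
from the entries to the determinant: if two square matrices `X`, `Y` of size `r + 1` with entries of
degree `≤ d` agree entrywise modulo degree-`0` combinations, then `det X - det Y` is a combination
of degree `≤ r · d` (`lc_det_sub_det`: replace the rows of `Y` by those of `X` one at a time and
Laplace-expand the difference along the changed row). [folklore]
-/

noncomputable section

-- single-conjunct layout: Sub = Summit, duplicated namespace component intended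
set_option linter.dupNamespace false

namespace Summit.ValiantsHypothesis.ValiantsHypothesis.Theorems.RefutationDegreeMrCalibration

open MvPolynomial Matrix

section LinComb

variable {K : Type*} [CommRing K] {σ τ : Type*} (P : MvPolynomial τ (MvPolynomial σ K))

/-- `LC[P, d, f]`: `f` is a combination `Σ_{μ ∈ supp P} h_μ · coeff_μ P` with `deg h_μ ≤ d`
(local notation; the item's statement inlines it). -/
local notation3 "LC[" P ", " d ", " f "]" =>
  ∃ h : (τ →₀ ℕ) → MvPolynomial σ K, (∀ μ, MvPolynomial.totalDegree (h μ) ≤ d) ∧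
    (∑ μ ∈ MvPolynomial.support P, h μ * MvPolynomial.coeff μ P) = f

/-- An explicit combination of the coefficients is a combination. [folklore] -/
theorem lc_of_coeffs (c : (τ →₀ ℕ) → MvPolynomial σ K) {d : ℕ}
    (hc : ∀ μ, (c μ).totalDegree ≤ d) : LC[P, d, ∑ μ ∈ P.support, c μ * P.coeff μ] :=
  ⟨c, hc, rfl⟩

/-- `0` is a combination. [folklore] -/
theorem lc_zero (d : ℕ) : LC[P, d, 0] :=
  ⟨0, fun _ => by simp, by simp⟩

/-- Combinations are stable under addition. [folklore] -/
theorem lc_add {d : ℕ} {f g : MvPolynomial σ K} (hf : LC[P, d, f]) (hg : LC[P, d, g]) :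
    LC[P, d, f + g] := by
  obtain ⟨h₁, hd₁, rfl⟩ := hf
  obtain ⟨h₂, hd₂, rfl⟩ := hg
  refine ⟨h₁ + h₂, fun μ => (totalDegree_add _ _).trans (max_le (hd₁ μ) (hd₂ μ)), ?_⟩
  rw [← Finset.sum_add_distrib]
  exact Finset.sum_congr rfl fun μ _ => by simp [add_mul]

/-- Combinations are stable under negation. [folklore] -/
theorem lc_neg {d : ℕ} {f : MvPolynomial σ K} (hf : LC[P, d, f]) : LC[P, d, -f] := by
  obtain ⟨h, hd, rfl⟩ := hf
  refine ⟨-h, fun μ => by simpa using hd μ, ?_⟩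
  rw [← Finset.sum_neg_distrib]
  exact Finset.sum_congr rfl fun μ _ => by simp

/-- Combinations are stable under subtraction. [folklore] -/
theorem lc_sub {d : ℕ} {f g : MvPolynomial σ K} (hf : LC[P, d, f]) (hg : LC[P, d, g]) :
    LC[P, d, f - g] := by
  rw [sub_eq_add_neg]
  exact lc_add P hf (lc_neg P hg)

/-- Combinations are stable under finite sums. [folklore] -/
theorem lc_sum {ι : Type*} (s : Finset ι) (f : ι → MvPolynomial σ K) {d : ℕ}
    (hf : ∀ i ∈ s, LC[P, d, f i]) : LC[P, d, ∑ i ∈ s, f i] := by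
  classical
  induction s using Finset.induction_on with
  | empty => rw [Finset.sum_empty]; exact lc_zero P d
  | insert a s ha ih =>
      rw [Finset.sum_insert ha]
      exact lc_add P (hf a (Finset.mem_insert_self a s))
        (ih fun i hi => hf i (Finset.mem_insert_of_mem hi))

/-- Multiplying a combination of degree `≤ d` by a polynomial of degree `≤ e` gives a combination
of degree `≤ e + d`. [folklore] -/
theorem lc_mul {d e d' : ℕ} {f : MvPolynomial σ K} (g : MvPolynomial σ K)
    (hg : g.totalDegree ≤ e) (hf : LC[P, d, f]) (hd' : e + d ≤ d') : LC[P, d', g * f] := by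
  obtain ⟨h, hd, rfl⟩ := hf
  refine ⟨fun μ => g * h μ,
    fun μ => ((totalDegree_mul _ _).trans (add_le_add hg (hd μ))).trans hd', ?_⟩
  rw [Finset.mul_sum]
  exact Finset.sum_congr rfl fun μ _ => by ring

/-- **From entries to determinants.** If `X`, `Y` are square matrices of size `r + 1` over
`R = K[a]` with entries of degree `≤ d`, and every difference `X i j - Y i j` is a degree-`0`
combination of the coefficients of `P`, then `det X - det Y` is a combination of degree `≤ r · d`:
replace the rows of `Y` by those of `X` one at a time; each step changes the determinant by
`det` of a matrix with one row of differences, which is Laplace-expanded along that row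
(cofactors: `r × r` minors with entries of degree `≤ d`). [folklore] -/
theorem lc_det_sub_det {r : ℕ} (X Y : Matrix (Fin (r + 1)) (Fin (r + 1)) (MvPolynomial σ K))
    {d : ℕ} (hX : ∀ i j, (X i j).totalDegree ≤ d) (hY : ∀ i j, (Y i j).totalDegree ≤ d)
    (hXY : ∀ i j, LC[P, 0, X i j - Y i j]) : LC[P, r * d, X.det - Y.det] := by
  classical
  -- the hybrid matrices: rows `< t` from `X`, the others from `Y`
  let Z : ℕ → Matrix (Fin (r + 1)) (Fin (r + 1)) (MvPolynomial σ K) :=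
    fun t => Matrix.of fun i j => if (i : ℕ) < t then X i j else Y i j
  have hZ0 : Z 0 = Y := by
    ext i j
    simp [Z]
  have hZr : Z (r + 1) = X := by
    ext i j
    simp [Z, i.is_lt]
  have hZdeg : ∀ t i j, (Z t i j).totalDegree ≤ d := fun t i j => by
    simp only [Z, Matrix.of_apply]
    split_ifs
    exacts [hX i j, hY i j]
  -- one step of the telescope
  have hstep : ∀ t : Fin (r + 1), LC[P, r * d, (Z ((t : ℕ) + 1)).det - (Z t).det] := by
    intro t
    have h1 : Z ((t : ℕ) + 1) = (Z t).updateRow t (X t) := by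
      ext i j
      simp only [Z, Matrix.of_apply, Matrix.updateRow_apply]
      by_cases hit : i = t
      · subst hit
        simp
      · have hne : (i : ℕ) ≠ (t : ℕ) := fun h => hit (Fin.ext h)
        have hiff : ((i : ℕ) < (t : ℕ) + 1) ↔ ((i : ℕ) < (t : ℕ)) := by omega
        simp only [hiff, if_neg hit]
    have h2 : ((Z t).updateRow t (Y t)).det = (Z t).det := by
      have : (Z t).updateRow t (Y t) = Z t := by
        ext i j
        simp only [Z, Matrix.of_apply, Matrix.updateRow_apply]
        by_cases hit : i = t
        · subst hit
          simp
        · rw [if_neg hit]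
      rw [this]
    have h3 : (Z ((t : ℕ) + 1)).det - (Z t).det = ((Z t).updateRow t (X t - Y t)).det := by
      rw [h1, ← h2, sub_eq_iff_eq_add, ← Matrix.det_updateRow_add, sub_add_cancel]
    rw [h3, Matrix.det_succ_row _ t]
    refine lc_sum P _ _ fun j _ => ?_
    rw [Matrix.updateRow_self, Pi.sub_apply]
    have hsub : ((Z t).updateRow t (X t - Y t)).submatrix t.succAbove j.succAbove =
        (Z t).submatrix t.succAbove j.succAbove := by
      ext a b
      simp only [Matrix.submatrix_apply, Matrix.updateRow_ne (Fin.succAbove_ne t a)]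
    rw [hsub]
    have hdet : ((Z t).submatrix t.succAbove j.succAbove).det.totalDegree ≤ r * d := by
      have := totalDegree_det_le ((Z t).submatrix t.succAbove j.succAbove) (d := d)
        fun a b => hZdeg _ _ _
      simpa using this
    have hsign : ((-1 : MvPolynomial σ K) ^ ((t : ℕ) + j) *
        ((Z t).submatrix t.succAbove j.succAbove).det).totalDegree ≤ r * d := by
      refine (totalDegree_mul _ _).trans ?_
      refine (add_le_add ((totalDegree_pow _ _).trans ?_) hdet).trans_eq (zero_add _)
      rw [totalDegree_neg, totalDegree_one, mul_zero]
    have key := lc_mul P _ hsign (hXY t j) (le_refl (r * d + 0))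
    have e : (-1 : MvPolynomial σ K) ^ ((t : ℕ) + j) * (X t j - Y t j) *
        ((Z t).submatrix t.succAbove j.succAbove).det =
        (-1 : MvPolynomial σ K) ^ ((t : ℕ) + j) *
          ((Z t).submatrix t.succAbove j.succAbove).det * (X t j - Y t j) := by ring
    rw [e]
    simpa only [add_zero] using key
  -- telescope
  have htel : X.det - Y.det = ∑ t ∈ Finset.range (r + 1), ((Z (t + 1)).det - (Z t).det) := by
    rw [Finset.sum_range_sub (fun t => (Z t).det), hZr, hZ0]
  rw [htel]
  refine lc_sum P _ _ fun t ht => ?_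
  exact hstep ⟨t, Finset.mem_range.mp ht⟩

end LinComb

end Summit.ValiantsHypothesis.ValiantsHypothesis.Theorems.RefutationDegreeMrCalibration
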